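import Summits.HubbardSuperconductivity.HubbardSuperconductivity.Theorems.BcsKacWindowInfraredCompletionSqrtShape
import Summits.HubbardSuperconductivity.HubbardSuperconductivity.Theorems.FunctionFieldCertificateWindowInfraredBoundEngines

/-!
# Crux `InfraredCompletion` (stmt-HubbardSuperconductivity-1321, route BcsKacWindow), line `birth`:
# the moment-method engine with a RELATIVE pair stiffness delivers the sqrt-shape (pointwise)

Companion of `BcsKacWindowInfraredCompletionSqrtShape.lean` (floor + sqrt-shape ⇒ bulk order) and of
`FunctionFieldCertificateWindowInfraredBoundEngines.lean` (§4, engine B: the landed `T = 0`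
Pitaevskii–Stringari moment closure `goldstoneShape_of_momentClosure` of the sibling crux
`WindowInfraredBound`, `S_ψ(m)·|q_m| ≤ √((C₁ + C₃C₂) C_X) + κ C_X/π` from a variational torus pair
stiffness `X ≤ C_X L²/|q_m|²`, the two landed commutator budgets, the two-particle cost and the
charging floor `pairGap ≥ -κ/L`).

Here the stiffness input is taken in the RELATIVE (Goldstone / phase-stiffness) form
`X ≤ (S_ψ(0)/ρ₀ + B'|q_m|²L²)/|q_m|²`, i.e. `C_X = S_ψ(0)/(ρ₀L²) + B'|q_m|²`, and the engine
output is regrouped, by real arithmetic only (`√(u+v) ≤ √u + √v`, the Parseval ceiling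
`S_ψ(0) ≤ Σ_m S_ψ(m) ≤ 32L²` from the landed `wib_sum_pairStructureFactor_le`, and the
Brillouin-zone range `|q_m|² ≤ 2π²`), into exactly the sqrt-shape of stub B3 of skeleton v5 of
line `birth`:

  `S_ψ(m)·|q_m|·L² ≤ (√((C₁+C₃C₂)/ρ₀) + κ√32/(πρ₀)) · L · √S_ψ(0)`
  `                    + (√((C₁+C₃C₂)B') + √2 κ B') · |q_m| · L²`

(`sqrtShape_of_relStiffness_pointwise`; the pure arithmetic is `sqrtShape_arith_of_engine`). This is
the registered sub-goal `sqrtShape_of_relStiffness_pointwise` of the crux skeleton: a pointwise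
implication, one state, one momentum; it does NOT assert the stiffness input. No definitions, no named
facts, `sorry`-free.

Sources: L. Pitaevskii, S. Stringari, J. Low Temp. Phys. **85** (1991) 377 (the `T = 0` uncertainty
inequality `m₀² ≤ m₁ m₋₁`); T. Kennedy, E. H. Lieb, B. S. Shastry, PRL **61** (1988) 2582 (Goldstone
shape of the infrared bound, Parseval sum rule). [folklore]
-/

noncomputable section

-- the mandated namespace `Summit.<Summit>.<Problem>.Theorems…` repeats `HubbardSuperconductivity`
-- (single-problem summit, D-0017), which the `dupNamespace` linter flags on every declaration
set_option linter.dupNamespace false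

namespace Summit.HubbardSuperconductivity.HubbardSuperconductivity.Theorems.InfraredCompletion

open Literature.MathematicalPhysics.QuantumLattice Literature.Probability.LatticeModels
open scoped Matrix

/-! ### The real arithmetic: engine output ⇒ sqrt-shape -/

/-- **Engine output ⇒ sqrt-shape (pure real arithmetic).** With `ℓ = L > 0`, `Q = |q_m|² > 0`,
`S0 = S_ψ(0) ≥ 0`, `C' = C₁ + C₃C₂ ≥ 0`: if `Sm·√Q ≤ √(C'·C_X) + κ C_X/π` for
`C_X = S0/(ρ₀ℓ²) + B'Q` (the moment-method engine fed the relative stiffness), `Q ≤ 2π²`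
(Brillouin zone) and `S0 ≤ 32ℓ²` (Parseval), then
`Sm·√Q·ℓ² ≤ (√(C'/ρ₀) + κ√32/(πρ₀))·ℓ·√S0 + (√(C'B') + √2κB')·√Q·ℓ²`:
`√(C' C_X) ≤ √(C'/ρ₀)·√S0/ℓ + √(C'B')·√Q`, `S0 ≤ √32·ℓ·√S0`, `Q ≤ √2·π·√Q`.
Pitaevskii–Stringari, J. Low Temp. Phys. 85 (1991) 377; Kennedy–Lieb–Shastry, PRL 61 (1988) 2582.
[folklore] -/
theorem sqrtShape_arith_of_engine {Sm S0 Q ℓ ρ₀ B' C' κ : ℝ} (hℓ : 0 < ℓ) (hQ : 0 < Q)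
    (hS0 : 0 ≤ S0) (hρ₀ : 0 < ρ₀) (hB' : 0 ≤ B') (hC' : 0 ≤ C') (hκ : 0 ≤ κ)
    (hQπ : Q ≤ 2 * Real.pi ^ 2) (hS32 : S0 ≤ 32 * ℓ ^ 2)
    (hG : Sm * Real.sqrt Q ≤ Real.sqrt (C' * (S0 / (ρ₀ * ℓ ^ 2) + B' * Q)) +
      κ * (S0 / (ρ₀ * ℓ ^ 2) + B' * Q) / Real.pi) :
    Sm * Real.sqrt Q * ℓ ^ 2 ≤
      (Real.sqrt (C' / ρ₀) + κ * Real.sqrt 32 / (Real.pi * ρ₀)) * ℓ * Real.sqrt S0 +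
        (Real.sqrt (C' * B') + Real.sqrt 2 * κ * B') * Real.sqrt Q * ℓ ^ 2 := by
  have hπ : 0 < Real.pi := Real.pi_pos
  obtain ⟨r, hr⟩ : ∃ r, r = Real.sqrt Q := ⟨_, rfl⟩
  obtain ⟨s, hs⟩ : ∃ s, s = Real.sqrt S0 := ⟨_, rfl⟩
  rw [← hr] at hG ⊢
  rw [← hs]
  have hr0 : 0 < r := hr ▸ Real.sqrt_pos.2 hQ
  have hrr : r * r = Q := hr ▸ Real.mul_self_sqrt hQ.le
  have hs0 : 0 ≤ s := hs ▸ Real.sqrt_nonneg _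
  have hss : s * s = S0 := hs ▸ Real.mul_self_sqrt hS0
  -- `√S0 ≤ √32 ℓ` (Parseval) and `√Q ≤ √2 π` (Brillouin zone)
  have hs32 : s ≤ Real.sqrt 32 * ℓ := by
    rw [hs]
    calc Real.sqrt S0 ≤ Real.sqrt (32 * ℓ ^ 2) := Real.sqrt_le_sqrt hS32
      _ = Real.sqrt 32 * ℓ := by
          rw [Real.sqrt_mul (by norm_num : (0:ℝ) ≤ 32), Real.sqrt_sq hℓ.le]
  have hrπ : r ≤ Real.sqrt 2 * Real.pi := by
    rw [hr]
    calc Real.sqrt Q ≤ Real.sqrt (2 * Real.pi ^ 2) := Real.sqrt_le_sqrt hQπ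
      _ = Real.sqrt 2 * Real.pi := by
          rw [Real.sqrt_mul (by norm_num : (0:ℝ) ≤ 2), Real.sqrt_sq hπ.le]
  -- `√(x + y) ≤ √x + √y`
  have hsub : ∀ {x y : ℝ}, 0 ≤ x → 0 ≤ y → Real.sqrt (x + y) ≤ Real.sqrt x + Real.sqrt y := by
    intro x y hx hy
    rw [Real.sqrt_le_left (by positivity)]
    nlinarith [Real.sq_sqrt hx, Real.sq_sqrt hy, Real.sqrt_nonneg x, Real.sqrt_nonneg y]
  -- (i) the square-root term
  have h1 : Real.sqrt (C' * (S0 / (ρ₀ * ℓ ^ 2) + B' * Q)) ≤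
      Real.sqrt (C' / ρ₀) * (s / ℓ) + Real.sqrt (C' * B') * r := by
    have e1 : C' * (S0 / (ρ₀ * ℓ ^ 2) + B' * Q) = C' / ρ₀ * (s / ℓ) ^ 2 + C' * B' * r ^ 2 := by
      rw [← hss, ← hrr]
      field_simp
    rw [e1]
    calc Real.sqrt (C' / ρ₀ * (s / ℓ) ^ 2 + C' * B' * r ^ 2)
        ≤ Real.sqrt (C' / ρ₀ * (s / ℓ) ^ 2) + Real.sqrt (C' * B' * r ^ 2) :=
          hsub (by positivity) (by positivity)
      _ = Real.sqrt (C' / ρ₀) * (s / ℓ) + Real.sqrt (C' * B') * r := by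
          rw [Real.sqrt_mul' _ (sq_nonneg _), Real.sqrt_mul' _ (sq_nonneg _),
            Real.sqrt_sq (by positivity), Real.sqrt_sq hr0.le]
  have hA : Real.sqrt (C' * (S0 / (ρ₀ * ℓ ^ 2) + B' * Q)) * ℓ ^ 2 ≤
      Real.sqrt (C' / ρ₀) * ℓ * s + Real.sqrt (C' * B') * r * ℓ ^ 2 := by
    have h := mul_le_mul_of_nonneg_right h1 (by positivity : (0:ℝ) ≤ ℓ ^ 2)
    have e : (Real.sqrt (C' / ρ₀) * (s / ℓ) + Real.sqrt (C' * B') * r) * ℓ ^ 2 =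
        Real.sqrt (C' / ρ₀) * ℓ * s + Real.sqrt (C' * B') * r * ℓ ^ 2 := by
      field_simp
    linarith only [h, e]
  -- (ii) the charging term
  have h2 : S0 ≤ Real.sqrt 32 * ℓ * s := by
    calc S0 = s * s := hss.symm
      _ ≤ Real.sqrt 32 * ℓ * s := mul_le_mul_of_nonneg_right hs32 hs0
  have h3 : Q ≤ Real.sqrt 2 * Real.pi * r := by
    calc Q = r * r := hrr.symm
      _ ≤ Real.sqrt 2 * Real.pi * r := mul_le_mul_of_nonneg_right hrπ hr0.le
  have hB : κ * (S0 / (ρ₀ * ℓ ^ 2) + B' * Q) / Real.pi * ℓ ^ 2 ≤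
      κ * Real.sqrt 32 / (Real.pi * ρ₀) * ℓ * s + Real.sqrt 2 * κ * B' * r * ℓ ^ 2 := by
    have e : κ * (S0 / (ρ₀ * ℓ ^ 2) + B' * Q) / Real.pi * ℓ ^ 2 =
        κ / (Real.pi * ρ₀) * S0 + κ * B' * ℓ ^ 2 / Real.pi * Q := by
      field_simp
    rw [e]
    have i1 : κ / (Real.pi * ρ₀) * S0 ≤ κ / (Real.pi * ρ₀) * (Real.sqrt 32 * ℓ * s) :=
      mul_le_mul_of_nonneg_left h2 (by positivity)
    have i2 : κ * B' * ℓ ^ 2 / Real.pi * Q ≤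
        κ * B' * ℓ ^ 2 / Real.pi * (Real.sqrt 2 * Real.pi * r) :=
      mul_le_mul_of_nonneg_left h3 (by positivity)
    have e1 : κ / (Real.pi * ρ₀) * (Real.sqrt 32 * ℓ * s) =
        κ * Real.sqrt 32 / (Real.pi * ρ₀) * ℓ * s := by ring
    have e2 : κ * B' * ℓ ^ 2 / Real.pi * (Real.sqrt 2 * Real.pi * r) =
        Real.sqrt 2 * κ * B' * r * ℓ ^ 2 := by
      field_simp
    linarith only [i1, i2, e1, e2]
  calc Sm * r * ℓ ^ 2
      ≤ (Real.sqrt (C' * (S0 / (ρ₀ * ℓ ^ 2) + B' * Q)) +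
          κ * (S0 / (ρ₀ * ℓ ^ 2) + B' * Q) / Real.pi) * ℓ ^ 2 :=
        mul_le_mul_of_nonneg_right hG (by positivity)
    _ = Real.sqrt (C' * (S0 / (ρ₀ * ℓ ^ 2) + B' * Q)) * ℓ ^ 2 +
          κ * (S0 / (ρ₀ * ℓ ^ 2) + B' * Q) / Real.pi * ℓ ^ 2 := by ring
    _ ≤ (Real.sqrt (C' / ρ₀) * ℓ * s + Real.sqrt (C' * B') * r * ℓ ^ 2) +
          (κ * Real.sqrt 32 / (Real.pi * ρ₀) * ℓ * s + Real.sqrt 2 * κ * B' * r * ℓ ^ 2) :=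
        add_le_add hA hB
    _ = (Real.sqrt (C' / ρ₀) + κ * Real.sqrt 32 / (Real.pi * ρ₀)) * ℓ * s +
          (Real.sqrt (C' * B') + Real.sqrt 2 * κ * B') * r * ℓ ^ 2 := by ring

/-! ### The engine with relative stiffness ⇒ the sqrt-shape, pointwise -/

/-- **Moment-method engine with RELATIVE pair stiffness ⇒ sqrt-shape, one state, one momentum.**
Let `ψ` be a normalised `(N, S^z = 0)`-sector ground state of `H = hubbardTorus 2 L 1 U`, `N ≥ 2`,
`m ≠ 0`, `Δ = pairFieldAt dWaveFormFactor L m`, `S_ψ = pairStructureFactor dWaveFormFactor L ψ`,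
`|q_m|² = momentumNormSq L m`. IF the variational torus pair stiffness holds in the RELATIVE
(phase-stiffness) form `2Re⟨w, Δψ⟩ - Re⟨w, (H - E(N-2))w⟩ ≤ (S_ψ(0)/ρ₀ + B'|q_m|²L²)/|q_m|²` on
`(N-2, 0)` and its twin with `Δᴴψ`, `E(N+2)` on `(N+2, 0)`, together with the double-commutator
budget `C₁L²`, the pair-commutator budget `C₂L²`, the two-particle cost `C₃` and the charging floor
`pairGap ≥ -κ/L`, THEN the landed engine `goldstoneShape_of_momentClosure` (with
`C_X = S_ψ(0)/(ρ₀L²) + B'|q_m|²`) and the arithmetic `sqrtShape_arith_of_engine` give the sqrt-shape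
`S_ψ(m)|q_m|L² ≤ (√((C₁+C₃C₂)/ρ₀) + κ√32/(πρ₀)) L √S_ψ(0) + (√((C₁+C₃C₂)B') + √2κB') |q_m| L²`.
Registered sub-goal of line `birth` (skeleton v5) of the crux `InfraredCompletion`.
Pitaevskii–Stringari, J. Low Temp. Phys. 85 (1991) 377; Kennedy–Lieb–Shastry, PRL 61 (1988) 2582
[folklore] -/
theorem sqrtShape_of_relStiffness_pointwise :
    ∀ (U : ℝ) (L : ℕ) [NeZero L] (N : ℕ), 2 ≤ N →
      ∀ ψ : Fock (Orb (FermionTorus 2 L)), IsGroundStateInSector (hubbardTorus 2 L 1 U) N 0 ψ →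
        star ψ ⬝ᵥ ψ = 1 →
      ∀ m : TorusSite 2 L, m ≠ 0 →
      ∀ (ρ₀ B' C₁ C₂ C₃ κ : ℝ), 0 < ρ₀ → 0 ≤ B' → 0 ≤ C₁ → 0 ≤ C₂ → 0 ≤ C₃ → 0 ≤ κ →
      (∀ w : Fock (Orb (FermionTorus 2 L)), w ∈ szSector (Λ := FermionTorus 2 L) (N - 2) 0 →
        2 * (star w ⬝ᵥ (pairFieldAt dWaveFormFactor L m *ᵥ ψ)).re -
          ((star w ⬝ᵥ (hubbardTorus 2 L 1 U *ᵥ w)).re -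
            (hubbardTorus 2 L 1 U).minEnergyOn (szSector (N - 2) 0) * (star w ⬝ᵥ w).re) ≤
          (pairStructureFactor dWaveFormFactor L ψ 0 / ρ₀ +
              B' * momentumNormSq L m * (L : ℝ) ^ 2) / momentumNormSq L m) →
      (∀ w : Fock (Orb (FermionTorus 2 L)), w ∈ szSector (Λ := FermionTorus 2 L) (N + 2) 0 →
        2 * (star w ⬝ᵥ ((pairFieldAt dWaveFormFactor L m)ᴴ *ᵥ ψ)).re -
          ((star w ⬝ᵥ (hubbardTorus 2 L 1 U *ᵥ w)).re -
            (hubbardTorus 2 L 1 U).minEnergyOn (szSector (N + 2) 0) * (star w ⬝ᵥ w).re) ≤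
          (pairStructureFactor dWaveFormFactor L ψ 0 / ρ₀ +
              B' * momentumNormSq L m * (L : ℝ) ^ 2) / momentumNormSq L m) →
      (star ψ ⬝ᵥ (((pairFieldAt dWaveFormFactor L m)ᴴ *
          (hubbardTorus 2 L 1 U * pairFieldAt dWaveFormFactor L m -
            pairFieldAt dWaveFormFactor L m * hubbardTorus 2 L 1 U) -
          (hubbardTorus 2 L 1 U * pairFieldAt dWaveFormFactor L m -
            pairFieldAt dWaveFormFactor L m * hubbardTorus 2 L 1 U) *
          (pairFieldAt dWaveFormFactor L m)ᴴ) *ᵥ ψ)).re ≤ C₁ * (L : ℝ) ^ 2 →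
      |(star ψ ⬝ᵥ (((pairFieldAt dWaveFormFactor L m)ᴴ * pairFieldAt dWaveFormFactor L m -
          pairFieldAt dWaveFormFactor L m * (pairFieldAt dWaveFormFactor L m)ᴴ) *ᵥ ψ)).re| ≤
          C₂ * (L : ℝ) ^ 2 →
      |(hubbardTorus 2 L 1 U).minEnergyOn (szSector N 0) -
          (hubbardTorus 2 L 1 U).minEnergyOn (szSector (N - 2) 0)| ≤ C₃ →
      -(κ / (L : ℝ)) ≤ pairGap (hubbardTorus 2 L 1 U) N →
      pairStructureFactor dWaveFormFactor L ψ m * Real.sqrt (momentumNormSq L m) * (L : ℝ) ^ 2 ≤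
        (Real.sqrt ((C₁ + C₃ * C₂) / ρ₀) + κ * Real.sqrt 32 / (Real.pi * ρ₀)) * (L : ℝ) *
            Real.sqrt (pairStructureFactor dWaveFormFactor L ψ 0) +
          (Real.sqrt ((C₁ + C₃ * C₂) * B') + Real.sqrt 2 * κ * B') *
            Real.sqrt (momentumNormSq L m) * (L : ℝ) ^ 2 := by
  intro U L _ N hN ψ hψ hψ1 m hm ρ₀ B' C₁ C₂ C₃ κ hρ₀ hB' hC₁ hC₂ hC₃ hκ hTm hTp hF1 hF2 hF3 hC
  have hL0 : (0 : ℝ) < L := Nat.cast_pos.2 (Nat.pos_of_ne_zero (NeZero.ne L))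
  have hQ : 0 < momentumNormSq L m :=
    (momentumNormSq_nonneg m).lt_of_ne' (fun h0 => hm ((momentumNormSq_eq_zero_iff m).1 h0))
  have hS0 : 0 ≤ pairStructureFactor dWaveFormFactor L ψ 0 := pairStructureFactor_nonneg _ _ _ _
  -- Parseval: `S_ψ(0) ≤ Σ_m S_ψ(m) ≤ 32 L²` (landed `wib_sum_pairStructureFactor_le`)
  have hS32 : pairStructureFactor dWaveFormFactor L ψ 0 ≤ 32 * (L : ℝ) ^ 2 :=
    le_trans (Finset.single_le_sum (f := fun m' => pairStructureFactor dWaveFormFactor L ψ m')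
      (fun m' _ => pairStructureFactor_nonneg _ _ _ _) (Finset.mem_univ 0))
      (wib_sum_pairStructureFactor_le L ψ hψ1)
  -- Brillouin zone: `|q_m|² ≤ 2π²` (each reduced coordinate has `-L < 2·valMinAbs mᵢ ≤ L`)
  have hQπ : momentumNormSq L m ≤ 2 * Real.pi ^ 2 := by
    have hcoord : ∀ i : Fin 2, (((m i).valMinAbs : ℤ) : ℝ) ^ 2 ≤ (L : ℝ) ^ 2 / 4 := by
      intro i
      have h := ZMod.valMinAbs_mem_Ioc (m i)
      have h1 : (-(L : ℝ)) < ((m i).valMinAbs : ℝ) * 2 := by exact_mod_cast h.1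
      have h2 : ((m i).valMinAbs : ℝ) * 2 ≤ (L : ℝ) := by exact_mod_cast h.2
      nlinarith
    rw [momentumNormSq_apply, Fin.sum_univ_two]
    calc (2 * Real.pi / (L : ℝ)) ^ 2 *
          ((((m 0).valMinAbs : ℤ) : ℝ) ^ 2 + (((m 1).valMinAbs : ℤ) : ℝ) ^ 2)
        ≤ (2 * Real.pi / (L : ℝ)) ^ 2 * ((L : ℝ) ^ 2 / 4 + (L : ℝ) ^ 2 / 4) :=
          mul_le_mul_of_nonneg_left (add_le_add (hcoord 0) (hcoord 1)) (sq_nonneg _)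
      _ = 2 * Real.pi ^ 2 := by
          field_simp
          ring
  -- the relative stiffness in the engine's form `C_X L²/|q_m|²`, `C_X = S_ψ(0)/(ρ₀L²) + B'|q_m|²`
  have hCX : 0 ≤ pairStructureFactor dWaveFormFactor L ψ 0 / (ρ₀ * (L : ℝ) ^ 2) +
      B' * momentumNormSq L m := by positivity
  have hE : (pairStructureFactor dWaveFormFactor L ψ 0 / (ρ₀ * (L : ℝ) ^ 2) +
        B' * momentumNormSq L m) * (L : ℝ) ^ 2 / momentumNormSq L m =
      (pairStructureFactor dWaveFormFactor L ψ 0 / ρ₀ +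
        B' * momentumNormSq L m * (L : ℝ) ^ 2) / momentumNormSq L m := by
    congr 1
    field_simp
  have hG := goldstoneShape_of_momentClosure hN hψ hψ1 hm hCX hC₁ hC₂ hC₃ hκ
    (fun w hw => (hTm w hw).trans_eq hE.symm) (fun w hw => (hTp w hw).trans_eq hE.symm)
    hF1 hF2 hF3 hC
  exact sqrtShape_arith_of_engine hL0 hQ hS0 hρ₀ hB' (by positivity : (0:ℝ) ≤ C₁ + C₃ * C₂) hκ hQπ
    hS32 hG

end Summit.HubbardSuperconductivity.HubbardSuperconductivity.Theorems.InfraredCompletion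

end
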